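import Summits.QuantumFields.BalabanUV.Beta.D1BFx.SplitInstance
import Summits.QuantumFields.BalabanUV.Beta.D1BFx.FrozenCorner

/-!
# `BalabanUV.Beta.D1BFx.CornerRest` — road «BF-x» for binder row D1, slot (REST), the CORNER word: its punctured full sum is
# `(n⁻⁸·lam − 1)·Σ' w, w_μw_ν·bfKernel g N u_μ u_ν w` for an `R_μ`-invariant profile — hence EXACTLY ZERO under slot (K)'s normalisation `n⁻⁸·lam = 1`
# (the first (REST) member of `SplitInstance.RestIdx` closed, with constant `0`)

HONEST DEPENDENCY (page 1, mandatory): continuum YM on T⁴ ⇐ BetaPertH ∧ nine spine estimates (0/9 proved); BetaPertH ⇐ (D1) ∧ (D4) ∧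
CAP+tail; G-an2-4 gates asym, D1 and NE2/3/4.  HONEST FRAMING (cell contract, verbatim): «discharging `BetaPertH` makes Bałaban's UV
stability UNCONDITIONAL — a real constructive-QFT result; it is NOT the continuum limit and NOT the Clay problem.»  THIS MODULE DISCHARGES
NOTHING of the wall: [folklore] `tsum`∕`fullSum` bookkeeping BY NAME over `SplitInstance.restK_corner`, `FrozenCorner` (`cornerSub`, `bfKernel_cornerRefl`,
`tsum_corner_reindex_of_cornerOdd`), `ModelTablesRealised.stK_of_bfKernel`, an2's `WindowIdentification.fullSum_eq_tsum_sub` and `Assembly.fullSum_sub'`.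
No `def`, no `Prop` minted, nothing printed asserted, 0 sorry.  0 wall binders; NOT D1, NOT `BetaPertH`, NOT continuum, NOT Clay.

ABSOLUTE RULE (cell charter, verbatim): «No internally-minted statement may enter as a cited fact. Every hypothesis is either kernel-proved in
this package or a verbatim quotation of a PUBLISHED theorem with page reference. The manuscript(s) under audit are NOT citable for their own
disputed steps — they are the thing under adjudication; programme-internal (2001/route/tribunal) claims are never citable.»

WHY (`SPLIT-SPEC.md` v1.1 §4 «corner: `restK_corner` = 0 after summation (R-10′ + (K) normalisation)»).  The corner word of the term list is
`w ↦ n⁻⁸·w_μw_ν·lam·bfKernel g N u_μ u_ν (−w − u_μ) − stK μ ν N g w`; `stK = w_μw_ν·bfKernel` (part 4a); the substitution `t = −w − u_μ` costs one first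
moment (part 5d), which vanishes for an `R_μ`-invariant `g` (part 5d, `bfKernel_cornerRefl`).  So the slot (REST) bound for this word is the constant `0`
once `n⁻⁸·lam = 1` — and the file displays the defect `(n⁻⁸·lam − 1)·(second moment)` when it is not.
* `summable_corner_weight` (summability of `t ↦ t_μt_ν·K(−t − u_μ)` from the two weighted moments of `K`), `fullSum_weight₂_eq_tsum`, `fullSum_corner_eq_tsum`;
* **`fullSum_restK_corner`**: `fullSum (restK … corner) = (n⁻⁸·lam − 1)·Σ' w, w_μw_ν·bfKernel g N u_μ u_ν w`;
* **`fullSum_restK_corner_eq_zero`** (`n⁻⁸·lam = 1`); **`rest_corner_bound`**: the slot (REST) shape `|Σ_{b ∈ image resSite} n⁻⁴·fullSum (…)| ≤ 0` at fixed `n`.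
Unit `b2b-balaban-beta-d1-p2` (road owner, gen 2); `LEAVES-BFx.md` rows A1.ii ∕ REST (corner).
-/

open Finset Filter Topology
open scoped BigOperators
open Literature.MathematicalPhysics.QuantumFieldTheory.Balaban1983to89
open Literature.MathematicalPhysics.QuantumFieldTheory.Balaban1983to89.Beta
open WindowIdentification (fullSum psum fullSum_eq_tsum_sub exists_tendsto_psum_of_summable)
open DyadicShell (Pt toReal toReal_apply)
open BubbleTransfer (unitVec)
open SpinTable (bfKernel)
open SquareTable (stK)
open DressedMomentNormalisation (resSite)
open Summit.QuantumFields.BalabanUV.Beta.D1BFx.ReducedKernel (TableR)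
open Summit.QuantumFields.BalabanUV.Beta.D1BFx.Assembly (fullSum_sub')
open Summit.QuantumFields.BalabanUV.Beta.D1BFx.ModelTablesRealised (stK_of_bfKernel)
open Summit.QuantumFields.BalabanUV.Beta.D1BFx.FrozenCorner (negAt cornerSub cornerSub_apply bfKernel_cornerRefl tsum_corner_reindex_of_cornerOdd)
open Summit.QuantumFields.BalabanUV.Beta.D1BFx.SplitInstance (restK restK_corner)

namespace Summit.QuantumFields.BalabanUV.Beta.D1BFx.CornerRest

variable {μ ν : Fin 4}

/-- [folklore] Summability of the corner-substituted weighted kernel `t ↦ t_μt_ν·K (−t − u_μ)` from the summability of `w_μw_ν·K` and `w_ν·K` (μ ≠ ν). -/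
theorem summable_corner_weight (hμν : μ ≠ ν) {K : Pt → ℝ} (h2 : Summable fun w : Pt => (w μ : ℝ) * (w ν : ℝ) * K w)
    (h1 : Summable fun w : Pt => (w ν : ℝ) * K w) :
    Summable fun t : Pt => (t μ : ℝ) * (t ν : ℝ) * K (-t - unitVec μ) := by
  have hG : Summable fun w : Pt => ((w μ : ℝ) + 1) * (w ν : ℝ) * K w := by
    refine (h2.add h1).congr fun w => ?_
    ring
  have e : (fun t : Pt => (t μ : ℝ) * (t ν : ℝ) * K (-t - unitVec μ)) =
      (fun w : Pt => ((w μ : ℝ) + 1) * (w ν : ℝ) * K w) ∘ (cornerSub μ) := by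
    funext t
    simp only [Function.comp_apply, cornerSub_apply, Pi.sub_apply, Pi.neg_apply, unitVec, Pi.single_eq_same, Pi.single_eq_of_ne (Ne.symm hμν),
      Int.cast_sub, Int.cast_neg, Int.cast_one, sub_zero]
    ring
  rw [e]
  exact (cornerSub μ).summable_iff.mpr hG

/-- [folklore] For a summable weighted kernel, `fullSum (w ↦ w_μw_ν·K w) = Σ' w, w_μw_ν·K w` (the origin has weight `0`). -/
theorem fullSum_weight₂_eq_tsum {K : Pt → ℝ} (h2 : Summable fun w : Pt => (w μ : ℝ) * (w ν : ℝ) * K w) :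
    fullSum (fun w : Pt => toReal w μ * toReal w ν * K w) = ∑' w : Pt, (w μ : ℝ) * (w ν : ℝ) * K w := by
  have e : (fun w : Pt => toReal w μ * toReal w ν * K w) = fun w : Pt => (w μ : ℝ) * (w ν : ℝ) * K w := by
    funext w; simp only [toReal_apply]
  rw [e, fullSum_eq_tsum_sub _ h2]
  simp

/-- [folklore] The same for the corner-substituted kernel. -/
theorem fullSum_corner_eq_tsum (hμν : μ ≠ ν) {K : Pt → ℝ} (h2 : Summable fun w : Pt => (w μ : ℝ) * (w ν : ℝ) * K w)
    (h1 : Summable fun w : Pt => (w ν : ℝ) * K w) :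
    fullSum (fun t : Pt => toReal t μ * toReal t ν * K (-t - unitVec μ)) = ∑' t : Pt, (t μ : ℝ) * (t ν : ℝ) * K (-t - unitVec μ) := by
  have e : (fun t : Pt => toReal t μ * toReal t ν * K (-t - unitVec μ)) = fun t : Pt => (t μ : ℝ) * (t ν : ℝ) * K (-t - unitVec μ) := by
    funext w; simp only [toReal_apply]
  rw [e, fullSum_eq_tsum_sub _ (summable_corner_weight hμν h2 h1)]
  simp

section Corner

variable (n : ℕ) [NeZero n] (a : ℝ) {g : Pt → ℝ} (cE cΛ cR cK cQ cE₂ cJ4 cΛ₂ cR₂ cQ₂ x₀ : ℝ) (WE WJ WΛ WR WQ : TableR)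
  (ωgl ωgh lam N : ℝ) (b : Pt)

/-- [folklore] **THE FULL SUM OF THE CORNER WORD.**  For `μ ≠ ν`, an `R_μ`-invariant profile `g` whose realised kernel `bfKernel g N u_μ u_ν` has summable
weighted moments `w_μw_ν·K`, `w_ν·K`: `fullSum (restK … corner) = (n⁻⁸·lam − 1)·Σ' w, w_μw_ν·bfKernel g N u_μ u_ν w`. -/
theorem fullSum_restK_corner (hμν : μ ≠ ν) (hg : ∀ w, g (negAt μ w) = g w)
    (h2 : Summable fun w : Pt => (w μ : ℝ) * (w ν : ℝ) * bfKernel g N (unitVec μ) (unitVec ν) w)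
    (h1 : Summable fun w : Pt => (w ν : ℝ) * bfKernel g N (unitVec μ) (unitVec ν) w) :
    fullSum (restK n a g cE cΛ cR cK cQ cE₂ cJ4 cΛ₂ cR₂ cQ₂ x₀ WE WJ WΛ WR WQ ωgl ωgh lam N μ ν b (Sum.inr (Sum.inr (Sum.inr (Sum.inr 0))))) =
      (((n : ℝ) ^ 8)⁻¹ * lam - 1) * ∑' w : Pt, (w μ : ℝ) * (w ν : ℝ) * bfKernel g N (unitVec μ) (unitVec ν) w := by
  have hK : ∀ w, bfKernel g N (unitVec μ) (unitVec ν) (FrozenCorner.cornerRefl μ w) = -bfKernel g N (unitVec μ) (unitVec ν) w :=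
    fun w => bfKernel_cornerRefl (Ne.symm hμν) hg N w
  have h2' : Summable fun w : Pt => (w μ : ℝ) * (w ν : ℝ) * ((((n : ℝ) ^ 8)⁻¹ * lam) * bfKernel g N (unitVec μ) (unitVec ν) w) := by
    refine (h2.mul_left (((n : ℝ) ^ 8)⁻¹ * lam)).congr fun w => ?_; ring
  have h1' : Summable fun w : Pt => (w ν : ℝ) * ((((n : ℝ) ^ 8)⁻¹ * lam) * bfKernel g N (unitVec μ) (unitVec ν) w) := by
    refine (h1.mul_left (((n : ℝ) ^ 8)⁻¹ * lam)).congr fun w => ?_; ring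
  have hK' : ∀ w, (((n : ℝ) ^ 8)⁻¹ * lam) * bfKernel g N (unitVec μ) (unitVec ν) (FrozenCorner.cornerRefl μ w)
      = -((((n : ℝ) ^ 8)⁻¹ * lam) * bfKernel g N (unitVec μ) (unitVec ν) w) := fun w => by rw [hK, mul_neg]
  -- write the corner word as (substituted piece) − stK and split the full sum
  have e : restK n a g cE cΛ cR cK cQ cE₂ cJ4 cΛ₂ cR₂ cQ₂ x₀ WE WJ WΛ WR WQ ωgl ωgh lam N μ ν b (Sum.inr (Sum.inr (Sum.inr (Sum.inr 0)))) =
      fun w => toReal w μ * toReal w ν * ((((n : ℝ) ^ 8)⁻¹ * lam) * bfKernel g N (unitVec μ) (unitVec ν) (-w - unitVec μ))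
        - toReal w μ * toReal w ν * bfKernel g N (unitVec μ) (unitVec ν) w := by
    funext w
    rw [restK_corner, stK_of_bfKernel]
    ring
  rw [e, fullSum_sub' (exists_tendsto_psum_of_summable _ ?_) (exists_tendsto_psum_of_summable _ ?_),
    fullSum_corner_eq_tsum hμν h2' h1', fullSum_weight₂_eq_tsum h2,
    tsum_corner_reindex_of_cornerOdd hμν _ h2' h1' hK']
  · rw [show (fun w : Pt => (w μ : ℝ) * (w ν : ℝ) * ((((n : ℝ) ^ 8)⁻¹ * lam) * bfKernel g N (unitVec μ) (unitVec ν) w))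
        = fun w : Pt => (((n : ℝ) ^ 8)⁻¹ * lam) * ((w μ : ℝ) * (w ν : ℝ) * bfKernel g N (unitVec μ) (unitVec ν) w) from funext fun w => by ring,
      tsum_mul_left]
    ring
  · have e' : (fun t : Pt => toReal t μ * toReal t ν * ((((n : ℝ) ^ 8)⁻¹ * lam) * bfKernel g N (unitVec μ) (unitVec ν) (-t - unitVec μ)))
        = fun t : Pt => (t μ : ℝ) * (t ν : ℝ) * ((((n : ℝ) ^ 8)⁻¹ * lam) * bfKernel g N (unitVec μ) (unitVec ν) (-t - unitVec μ)) := by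
      funext w; simp only [toReal_apply]
    rw [e']
    exact summable_corner_weight hμν h2' h1'
  · have e' : (fun w : Pt => toReal w μ * toReal w ν * bfKernel g N (unitVec μ) (unitVec ν) w)
        = fun w : Pt => (w μ : ℝ) * (w ν : ℝ) * bfKernel g N (unitVec μ) (unitVec ν) w := by
      funext w; simp only [toReal_apply]
    rw [e']
    exact h2

/-- [folklore] **… HENCE ZERO UNDER SLOT (K)'s NORMALISATION `n⁻⁸·lam = 1`.** -/
theorem fullSum_restK_corner_eq_zero (hμν : μ ≠ ν) (hg : ∀ w, g (negAt μ w) = g w)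
    (h2 : Summable fun w : Pt => (w μ : ℝ) * (w ν : ℝ) * bfKernel g N (unitVec μ) (unitVec ν) w)
    (h1 : Summable fun w : Pt => (w ν : ℝ) * bfKernel g N (unitVec μ) (unitVec ν) w) (hnorm : ((n : ℝ) ^ 8)⁻¹ * lam = 1) :
    fullSum (restK n a g cE cΛ cR cK cQ cE₂ cJ4 cΛ₂ cR₂ cQ₂ x₀ WE WJ WΛ WR WQ ωgl ωgh lam N μ ν b (Sum.inr (Sum.inr (Sum.inr (Sum.inr 0))))) = 0 := by
  rw [fullSum_restK_corner n a cE cΛ cR cK cQ cE₂ cJ4 cΛ₂ cR₂ cQ₂ x₀ WE WJ WΛ WR WQ ωgl ωgh lam N b hμν hg h2 h1, hnorm, sub_self, zero_mul]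

end Corner

/-- [folklore] **THE SLOT (REST) BOUND FOR THE CORNER WORD AT BLOCK SIZE `n`, CONSTANT `0`**: with a base-site-dependent profile `gb b` (R-10′: `R_μ`-invariant at
every site, weighted moments of its realised kernel summable) and the normalisation `n⁻⁸·lam = 1`,
`|Σ_{b ∈ image resSite} n⁻⁴ · fullSum (restK … (gb b) … corner)| ≤ 0`. -/
theorem rest_corner_bound (n : ℕ) [NeZero n] (a : ℝ) {gb : Pt → Pt → ℝ} (cE cΛ cR cK cQ cE₂ cJ4 cΛ₂ cR₂ cQ₂ x₀ : ℝ) (WE WJ WΛ WR WQ : TableR)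
    (ωgl ωgh lam N : ℝ) (hμν : μ ≠ ν) (hg : ∀ b w, gb b (negAt μ w) = gb b w)
    (h2 : ∀ b, Summable fun w : Pt => (w μ : ℝ) * (w ν : ℝ) * bfKernel (gb b) N (unitVec μ) (unitVec ν) w)
    (h1 : ∀ b, Summable fun w : Pt => (w ν : ℝ) * bfKernel (gb b) N (unitVec μ) (unitVec ν) w) (hnorm : ((n : ℝ) ^ 8)⁻¹ * lam = 1) :
    |∑ b ∈ (univ : Finset (Fin 4 → Fin n)).image resSite, ((n : ℝ) ^ 4)⁻¹ *
      fullSum (restK n a (gb b) cE cΛ cR cK cQ cE₂ cJ4 cΛ₂ cR₂ cQ₂ x₀ WE WJ WΛ WR WQ ωgl ωgh lam N μ ν b (Sum.inr (Sum.inr (Sum.inr (Sum.inr 0)))))| ≤ 0 := by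
  rw [Finset.sum_eq_zero fun b _ => by
    rw [fullSum_restK_corner_eq_zero n a cE cΛ cR cK cQ cE₂ cJ4 cΛ₂ cR₂ cQ₂ x₀ WE WJ WΛ WR WQ ωgl ωgh lam N b hμν (hg b) (h2 b) (h1 b) hnorm, mul_zero]]
  simp

end Summit.QuantumFields.BalabanUV.Beta.D1BFx.CornerRest
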